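import Literature.Analysis.SegalBargmann.SchwartzCompactWeilRep
import HarnessLib

/-!
# The Bargmann dictionary ON `𝓢(ℝⁿ)`: `μ₀(U) B⁻¹F = B⁻¹(F ∘ U⁻¹)` for every polynomial symbol `F` (Folland 1989, §1.6–§1.7, Prop. (4.39))

Topic `Analysis/SegalBargmann`; namespace `Literature.Analysis.SegalBargmann`.  The tree's Bargmann transform
(`FockBargmann`: `bargmann : L²(ℝ^σ) ≃ₗᵢ 𝓕_σ`, `bargmann_symm_fockToL2 : B⁻¹(F e^{−π|z|²/2}) = hermToL2 (binv F)`,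
`binv` = the symbol of `B⁻¹` on polynomials, `FockHermite`) and its `U(σ)`-equivariance
(`FockUnitaryAction.fockRep_fockToL2 : ν₀(U)(F e^{−π|z|²/2}) = (F ∘ U⁻¹) e^{−π|z|²/2}`, `linSubst (star U)`) are `L²`
statements.  This file puts the dictionary on the SCHWARTZ space, where the pub-hodgecm printed Fock model lives:

* §1 `hermiteSchwartzPi p := schwartzTransport euclE (hermiteSchwartz p)` — the Hermite-span Schwartz function with
  symbol `p` on the Folland carrier (`hermiteSchwartzPi (herm α) = hermitePi α`), `toL2_hermiteSchwartzPi = hermToL2 p`,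
  linearity (`hermiteSchwartzPiₗ`);
* §2 **`binvPi F := hermiteSchwartzPi (binv F)` = `B⁻¹F ∈ 𝓢(ℝ^σ)`**, `toL2_binvPi : toL2 (B⁻¹F) = bargmann.symm (F e^{−π|z|²/2})`,
  `binvPi (zeta β) = hermitePi β` (rfl: `herm = binv ∘ zeta`), linearity;
* §3 **THE INTERTWINING ON `𝓢`**: `unitaryOpPi_binvPi : unitaryOpPi U (B⁻¹F) = B⁻¹(linSubst (star U) F)`, i.e. `μ₀(U)`
  acts on the Schwartz-function image of a Fock polynomial by the substitution `F ↦ F ∘ U⁻¹` — by `toL2`-injectivity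
  from `toL2_unitaryOpPi` (file `SchwartzUnitaryIdentification`) and the two `L²` facts above; hence
  **`compactWeilRep_binvPi : ω(h) (B⁻¹F) = χ h • B⁻¹(F ∘ (ι h)⁻¹)`** for the constructed compact Weil representation,
  and the same for ANY covariant Schwartz-level family (`IsRhoCovariantS.apply_binvPi`).

So an identity about the (constructed or abstract-but-covariant) archimedean Weil representation acting on `B⁻¹φ`,
`φ` a Fock POLYNOMIAL, is reduced to polynomial algebra (`linSubst`) — the form in which explicit Fock models state
torus weights, `κ`-isotypic lines and `K`-types.  Everything is proved from the imported tree files; no cited statement is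
used as a hypothesis.

## References

* [Folland1989] G. B. Folland, *Harmonic Analysis in Phase Space*, Princeton UP (1989), §1.6 (Bargmann transform),
  §1.7 (1.81)–(1.83) (Hermite functions), Prop. (4.39) (`μ(U) = B⁻¹ ν(U) B`). [cite: Folland1989, Prop (4.39)]

## Provenance

LEAN-IN-TREE rule (2026-08-18), pub-hodgecm model-construction sub-cell, seat mc-binder-2 gen 2 (rows A12/A34: the
`omg_ins` clause is stated on printed Fock polynomials).
-/

set_option autoImplicit false

noncomputable section

open MeasureTheory Complex SchwartzMap Filter Topology MvPolynomial
open scoped InnerProductSpace ComplexConjugate Real BigOperators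

namespace Literature.Analysis.SegalBargmann

variable {σ : Type*} [Fintype σ]

local notation "L2R" σ => Lp ℂ 2 (volume : Measure (σ → ℝ))
local notation "SR" σ => SchwartzMap (σ → ℝ) ℂ
local notation "SE" σ => SchwartzMap (EuclideanSpace ℝ σ) ℂ

/-! ## §1  Hermite-span Schwartz functions with arbitrary symbol on the Folland carrier -/

section Span

/-- **`p(x) e^{−π|x|²}` as a Schwartz function on `σ → ℝ`** (transport of the tree's `hermiteSchwartz p`).
[cite: Folland1989, §1.7] -/
def hermiteSchwartzPi (p : MvPolynomial σ ℂ) : SR σ := schwartzTransport (euclE σ) (hermiteSchwartz p)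

/-- Pointwise: `hermiteSchwartzPi p x = hermiteFun p x = p(x) e^{−π|x|²}`. [cite: Folland1989, §1.7] -/
@[simp] theorem hermiteSchwartzPi_apply (p : MvPolynomial σ ℂ) (x : σ → ℝ) :
    hermiteSchwartzPi p x = hermiteFun p x := by
  rw [hermiteSchwartzPi, schwartzTransport_apply, hermiteSchwartz_apply, coe_euclE_symm_apply]

/-- On Folland's symbols: `hermiteSchwartzPi (herm α) = hermitePi α`. [folklore] -/
@[simp] theorem hermiteSchwartzPi_herm [DecidableEq σ] (α : σ →₀ ℕ) :
    hermiteSchwartzPi (herm α) = (hermitePi α : SR σ) := rfl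

/-- `(schwartzTransport euclE)⁻¹ (hermiteSchwartzPi p) = hermiteSchwartz p`. [folklore] -/
@[simp] theorem schwartzTransport_symm_hermiteSchwartzPi (p : MvPolynomial σ ℂ) :
    (schwartzTransport (euclE σ)).symm (hermiteSchwartzPi p) = hermiteSchwartz p :=
  (schwartzTransport (euclE σ)).symm_apply_apply _

/-- **The `toL2` junction for arbitrary symbols**: `toL2 (hermiteSchwartzPi p) = hermToL2 p`. [cite: Folland1989, §1.7] -/
theorem toL2_hermiteSchwartzPi (p : MvPolynomial σ ℂ) : toL2 (hermiteSchwartzPi p) = (hermToL2 p : L2R σ) := by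
  apply Lp.ext
  filter_upwards [coeFn_toL2 (hermiteSchwartzPi p), hermToL2_coeFn p] with x h1 h2
  rw [h1, h2, hermiteSchwartzPi_apply]

/-- `p ↦ hermiteSchwartzPi p` is `ℂ`-linear. [folklore] -/
def hermiteSchwartzPiₗ : MvPolynomial σ ℂ →ₗ[ℂ] SR σ :=
  ((schwartzTransport (euclE σ) : (SE σ) ≃L[ℂ] SR σ) : (SE σ) →ₗ[ℂ] SR σ).comp hermiteSchwartzₗ

/-- Unfolding. [folklore] -/
@[simp] theorem hermiteSchwartzPiₗ_apply (p : MvPolynomial σ ℂ) : hermiteSchwartzPiₗ p = (hermiteSchwartzPi p : SR σ) :=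
  rfl

/-- Additivity in the symbol. [folklore] -/
theorem hermiteSchwartzPi_add (p q : MvPolynomial σ ℂ) :
    hermiteSchwartzPi (p + q) = (hermiteSchwartzPi p + hermiteSchwartzPi q : SR σ) := by
  rw [← hermiteSchwartzPiₗ_apply, map_add, hermiteSchwartzPiₗ_apply, hermiteSchwartzPiₗ_apply]

/-- Homogeneity in the symbol. [folklore] -/
theorem hermiteSchwartzPi_smul (c : ℂ) (p : MvPolynomial σ ℂ) :
    hermiteSchwartzPi (c • p) = (c • hermiteSchwartzPi p : SR σ) := by
  rw [← hermiteSchwartzPiₗ_apply, map_smul, hermiteSchwartzPiₗ_apply]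

/-- Injectivity in the symbol (tree `hermiteSchwartz_injective`). [folklore] -/
theorem hermiteSchwartzPi_injective : Function.Injective (hermiteSchwartzPi (σ := σ)) :=
  fun _ _ h => hermiteSchwartz_injective ((schwartzTransport (euclE σ)).injective h)

end Span

/-! ## §2  `B⁻¹F` as a Schwartz function -/

section Binv

variable [DecidableEq σ]

/-- **`B⁻¹F ∈ 𝓢(ℝ^σ)`** for a polynomial `F` on `ℂ^σ`: the Schwartz function with Hermite symbol `binv F`
(Folland (1.81)–(1.83): `B⁻¹ ζ_α = h_α`). [cite: Folland1989, §1.7] -/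
def binvPi (F : MvPolynomial σ ℂ) : SR σ := hermiteSchwartzPi (binv F)

/-- Unfolding. [folklore] -/
theorem binvPi_def (F : MvPolynomial σ ℂ) : binvPi F = (hermiteSchwartzPi (binv F) : SR σ) := rfl

/-- **`B⁻¹ ζ_β = h_β`** on `𝓢` (definitional: `herm β = binv (zeta β)`). [cite: Folland1989, §1.7] -/
@[simp] theorem binvPi_zeta (β : σ →₀ ℕ) : binvPi (zeta β) = (hermitePi β : SR σ) := rfl

/-- **`toL2 (B⁻¹F) = B⁻¹ (F e^{−π|z|²/2})`** (the tree's `bargmann_symm_fockToL2` on the image of `𝓢`).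
[cite: Folland1989, §1.6] -/
theorem toL2_binvPi (F : MvPolynomial σ ℂ) : toL2 (binvPi F) = bargmann.symm (fockToL2 F) := by
  rw [binvPi, toL2_hermiteSchwartzPi, bargmann_symm_fockToL2]

/-- … equivalently `B (toL2 (B⁻¹F)) = F e^{−π|z|²/2}`. [cite: Folland1989, §1.6] -/
theorem bargmann_toL2_binvPi (F : MvPolynomial σ ℂ) : bargmann (toL2 (binvPi F)) = fockToL2 F := by
  rw [toL2_binvPi, LinearIsometryEquiv.apply_symm_apply]

/-- `F ↦ B⁻¹F` is `ℂ`-linear. [folklore] -/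
def binvPiₗ : MvPolynomial σ ℂ →ₗ[ℂ] SR σ := hermiteSchwartzPiₗ.comp binv

/-- Unfolding. [folklore] -/
@[simp] theorem binvPiₗ_apply (F : MvPolynomial σ ℂ) : binvPiₗ F = (binvPi F : SR σ) := rfl

/-- Additivity. [folklore] -/
theorem binvPi_add (F G : MvPolynomial σ ℂ) : binvPi (F + G) = (binvPi F + binvPi G : SR σ) := by
  rw [← binvPiₗ_apply, map_add, binvPiₗ_apply, binvPiₗ_apply]

/-- Homogeneity. [folklore] -/
theorem binvPi_smul (c : ℂ) (F : MvPolynomial σ ℂ) : binvPi (c • F) = (c • binvPi F : SR σ) := by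
  rw [← binvPiₗ_apply, map_smul, binvPiₗ_apply]

end Binv

/-! ## §3  The intertwining `μ₀(U) B⁻¹ = B⁻¹ ∘ (· ∘ U⁻¹)` on `𝓢` -/

section Intertwining

variable [DecidableEq σ]

/-- **The Bargmann intertwining on the Schwartz space**: `μ₀(U) (B⁻¹F) = B⁻¹ (linSubst (star U) F)` — the unitary
`U ∈ U(σ)` acts on the Schwartz-function image of the Fock polynomial `F` by the substitution `F ↦ F ∘ U⁻¹`
(`toL2`-injectivity + `toL2_unitaryOpPi` + the `L²` facts `bargmann_symm_fockToL2`, `fockRep_fockToL2`).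
[cite: Folland1989, Prop (4.39)] -/
theorem unitaryOpPi_binvPi (U : Matrix.unitaryGroup σ ℂ) (F : MvPolynomial σ ℂ) :
    unitaryOpPi U (binvPi F) = binvPi (linSubst (star (U : Matrix σ σ ℂ)) F) := by
  apply toL2_injective
  rw [toL2_unitaryOpPi, toL2_binvPi, toL2_binvPi, schrodingerU_apply, LinearIsometryEquiv.apply_symm_apply,
    fockRep_fockToL2]

variable {H : Type*} [Group H]

/-- **The constructed compact Weil representation on Fock polynomials**: `ω(h) (B⁻¹F) = χ h • B⁻¹(F ∘ (ι h)⁻¹)`.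
[cite: Folland1989, Prop (4.39)] -/
theorem compactWeilRep_binvPi (ι : H →* Matrix.unitaryGroup σ ℂ) (χ : H →* Circle) (h : H) (F : MvPolynomial σ ℂ) :
    compactWeilRep ι χ h (binvPi F) =
      ((χ h : Circle) : ℂ) • binvPi (linSubst (star ((ι h : Matrix.unitaryGroup σ ℂ) : Matrix σ σ ℂ)) F) := by
  rw [compactWeilRep_apply, unitaryOpPi_binvPi]

variable {ι : H → Matrix.unitaryGroup σ ℂ} {ωS : H → ((SR σ) →ₗ[ℂ] SR σ)} {ω : H → ((L2R σ) ≃ₗᵢ[ℂ] L2R σ)}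

omit [Group H] in
/-- **Any covariant Schwartz-level family on Fock polynomials**: `ωS h (B⁻¹F) = vacCoeff ω h • B⁻¹(F ∘ (ι h)⁻¹)`.
[cite: Folland1989, Prop (4.39)] -/
theorem IsRhoCovariantS.apply_binvPi (hS : IsRhoCovariantS ι ωS) (hlift : ∀ h, LiftsTo (ωS h) (liftCLM ω h))
    (h : H) (F : MvPolynomial σ ℂ) :
    ωS h (binvPi F) = vacCoeff ω h • binvPi (linSubst (star ((ι h : Matrix.unitaryGroup σ ℂ) : Matrix σ σ ℂ)) F) := by
  rw [hS.apply_eq_vacCoeff_smul_unitaryOpPi hlift, unitaryOpPi_binvPi]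

/-- The Fourier transform on Fock polynomials: `𝓕 (B⁻¹F) = B⁻¹ (linSubst (−i·1) F)` — for a homogeneous `F` of
degree `d` this is `(−i)^d B⁻¹F` (tree `fourier_hermiteSchwartz_binv_of_isHomogeneous`); here the substitution form
for every `F`, from `fourierPi = unitaryOpPi (i·1)` read through the intertwining. [cite: Folland1989, §1.7] -/
theorem torusOpPi_negHalfPi_binvPi (F : MvPolynomial σ ℂ) :
    torusOpPi (fun _ : σ => -(π / 2)) (binvPi F) =
      binvPi (linSubst (star ((diagHom (torusPt fun _ : σ => -(π / 2)) : Matrix.unitaryGroup σ ℂ) :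
        Matrix σ σ ℂ)) F) := by
  rw [← unitaryOpPi_diagHom_torusPt, unitaryOpPi_binvPi]

end Intertwining

end Literature.Analysis.SegalBargmann
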